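import Mathlib

/-!
# Branch-free local triples = partial symmetries (kernel-checked classification, both directions)

Evidence file (refuter drefute g2, crux `HyperoctahedralSubsets`, stmt-MatrixMultiplication-8305, line `spherical-rank-sieve`).
Classification Lemma 2.2 of `EVIDENCE-g2.md` in pure permutation language, kernel-checked in BOTH directions
(`localTriple_of_partialSymmetry`, `partialSymmetry_of_localTriple`).  Converse direction:
if an involution `s` and two sets `A`, `B` satisfy
* `A` is a union of `M₀`-edges (`p ∈ A ↔ μ₀ p ∈ A`) on which `s` intertwines `μ₀` (`s (μ₀ p) = μ₀ (s p)` for `p ∈ A`), `A` is `s`-stable,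
* the same for `B`, `μ₁`,
* the same for the symmetric difference `A ∆ B` and `μ₂`,
then `a := s on A` (identity elsewhere) and `b := s on B` form a LOCAL TRIPLE in the sense of `stub_localTriples` /
`stub_triplesToGroup`: `a² = b² = 1`, `ab = ba`, `a ∈ C(μ₀)`, `b ∈ C(μ₁)`, `ab ∈ C(μ₂)` (and `ab = s` on `A ∆ B`).
Instances: a vertex-disjoint union `Z` of cycles of `Γ = M₀ ∪ M₁ ∪ M₂` with an fpf colour-preserving involutive automorphism `s`
(a symmetric cycle, a twin pair), `A` / `B` = vertices of `Z` carrying a `Z`-edge of colour 0 / 1.  No hypothesis on the `μ_i`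
(they need not be involutions) is used.
-/

set_option linter.dupNamespace false

namespace Summit.MatrixMultiplication.MatrixMultiplication.Cruxes.HyperoctahedralSubsets.DrefuteG2

open Equiv

variable {n : ℕ}

/-- The map "act as `s` on `A`, identity elsewhere". -/
def partialFun (A : Finset (Fin n)) (s : Perm (Fin n)) (p : Fin n) : Fin n :=
  if p ∈ A then s p else p

theorem partialFun_involutive (A : Finset (Fin n)) (s : Perm (Fin n)) (hs : ∀ p, s (s p) = p)
    (hA : ∀ p, p ∈ A ↔ s p ∈ A) : Function.Involutive (partialFun A s) := by
  intro p
  unfold partialFun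
  by_cases hp : p ∈ A
  · have hsp : s p ∈ A := (hA p).1 hp
    simp [hp, hsp, hs p]
  · simp [hp]

/-- `partialSym A s` as a permutation (an involution). -/
def partialSym (A : Finset (Fin n)) (s : Perm (Fin n)) (hs : ∀ p, s (s p) = p)
    (hA : ∀ p, p ∈ A ↔ s p ∈ A) : Perm (Fin n) :=
  (partialFun_involutive A s hs hA).toPerm _

@[simp] theorem partialSym_apply (A : Finset (Fin n)) (s : Perm (Fin n)) (hs : ∀ p, s (s p) = p)
    (hA : ∀ p, p ∈ A ↔ s p ∈ A) (p : Fin n) :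
    partialSym A s hs hA p = if p ∈ A then s p else p := rfl

theorem partialSym_mul_self (A : Finset (Fin n)) (s : Perm (Fin n)) (hs : ∀ p, s (s p) = p)
    (hA : ∀ p, p ∈ A ↔ s p ∈ A) : partialSym A s hs hA * partialSym A s hs hA = 1 := by
  ext p
  simp only [Perm.coe_mul, Function.comp_apply, Perm.coe_one, id_eq]
  exact congrArg Fin.val (partialFun_involutive A s hs hA p)

/-- A partial symmetry commutes with `μ` as soon as `A` is a union of `μ`-orbits of length ≤ 2 read through `μ`
(`p ∈ A ↔ μ p ∈ A`) and `s` intertwines `μ` on `A`. -/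
theorem partialSym_comm (A : Finset (Fin n)) (s : Perm (Fin n)) (hs : ∀ p, s (s p) = p)
    (hA : ∀ p, p ∈ A ↔ s p ∈ A) (μ : Perm (Fin n)) (hμA : ∀ p, p ∈ A ↔ μ p ∈ A)
    (hμs : ∀ p ∈ A, s (μ p) = μ (s p)) :
    partialSym A s hs hA * μ = μ * partialSym A s hs hA := by
  ext p
  simp only [Perm.coe_mul, Function.comp_apply, partialSym_apply]
  by_cases hp : p ∈ A
  · have hμp : μ p ∈ A := (hμA p).1 hp
    simp [hp, hμp, hμs p hp]
  · have hμp : μ p ∉ A := fun h => hp ((hμA p).2 h)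
    simp [hp, hμp]

/-- The product of the partial symmetries on `A` and on `B` is the partial symmetry on `A ∆ B`
(in particular they commute). -/
theorem partialSym_mul (A B : Finset (Fin n)) (s : Perm (Fin n)) (hs : ∀ p, s (s p) = p)
    (hA : ∀ p, p ∈ A ↔ s p ∈ A) (hB : ∀ p, p ∈ B ↔ s p ∈ B)
    (hAB : ∀ p, p ∈ symmDiff A B ↔ s p ∈ symmDiff A B) :
    partialSym A s hs hA * partialSym B s hs hB = partialSym (symmDiff A B) s hs hAB := by
  ext p
  simp only [Perm.coe_mul, Function.comp_apply, partialSym_apply, Finset.mem_symmDiff]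
  by_cases hpA : p ∈ A <;> by_cases hpB : p ∈ B
  · have hsA : s p ∈ A := (hA p).1 hpA
    simp [hpA, hpB, hsA, hs p]
  · simp [hpA, hpB]
  · have hsA : s p ∉ A := fun h => hpA ((hA p).2 h)
    simp [hpA, hpB, hsA]
  · simp [hpA, hpB]

theorem symmDiff_stable (A B : Finset (Fin n)) (s : Perm (Fin n))
    (hA : ∀ p, p ∈ A ↔ s p ∈ A) (hB : ∀ p, p ∈ B ↔ s p ∈ B) :
    ∀ p, p ∈ symmDiff A B ↔ s p ∈ symmDiff A B := by
  intro p
  simp only [Finset.mem_symmDiff]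
  rw [hA p, hB p]

/-- **Local triple from a partial symmetry.** With `a := s|A`, `b := s|B`: `a² = 1`, `b² = 1`, `ab = ba`, `aμ₀ = μ₀a`,
`bμ₁ = μ₁b`, `(ab)μ₂ = μ₂(ab)` — the local-triple clause of `stub_localTriples` / `stub_triplesToGroup` except non-triviality,
which is `partialSym_ne_one` below. -/
theorem localTriple_of_partialSymmetry (μ₀ μ₁ μ₂ s : Perm (Fin n)) (hs : ∀ p, s (s p) = p)
    (A B : Finset (Fin n))
    (hA : ∀ p, p ∈ A ↔ s p ∈ A) (hB : ∀ p, p ∈ B ↔ s p ∈ B)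
    (h0 : ∀ p, p ∈ A ↔ μ₀ p ∈ A) (h0s : ∀ p ∈ A, s (μ₀ p) = μ₀ (s p))
    (h1 : ∀ p, p ∈ B ↔ μ₁ p ∈ B) (h1s : ∀ p ∈ B, s (μ₁ p) = μ₁ (s p))
    (h2 : ∀ p, p ∈ symmDiff A B ↔ μ₂ p ∈ symmDiff A B) (h2s : ∀ p ∈ symmDiff A B, s (μ₂ p) = μ₂ (s p)) :
    let a := partialSym A s hs hA
    let b := partialSym B s hs hB
    a * a = 1 ∧ b * b = 1 ∧ a * b = b * a ∧ a * μ₀ = μ₀ * a ∧ b * μ₁ = μ₁ * b ∧ a * b * μ₂ = μ₂ * (a * b) := by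
  intro a b
  have hAB := symmDiff_stable A B s hA hB
  have hBA := symmDiff_stable B A s hB hA
  have hab : a * b = partialSym (symmDiff A B) s hs hAB := partialSym_mul A B s hs hA hB hAB
  have hba : b * a = partialSym (symmDiff B A) s hs hBA := partialSym_mul B A s hs hB hA hBA
  have hcomm : a * b = b * a := by
    rw [hab, hba]
    ext p
    simp only [partialSym_apply, Finset.mem_symmDiff]
    by_cases hpA : p ∈ A <;> by_cases hpB : p ∈ B <;> simp [hpA, hpB]
  refine ⟨partialSym_mul_self A s hs hA, partialSym_mul_self B s hs hB, hcomm,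
    partialSym_comm A s hs hA μ₀ h0 h0s, partialSym_comm B s hs hB μ₁ h1 h1s, ?_⟩
  rw [hab]
  exact partialSym_comm (symmDiff A B) s hs hAB μ₂ h2 h2s

/-- Non-triviality: if `s` moves some point of `A` then `a ≠ 1`. -/
theorem partialSym_ne_one (A : Finset (Fin n)) (s : Perm (Fin n)) (hs : ∀ p, s (s p) = p)
    (hA : ∀ p, p ∈ A ↔ s p ∈ A) {p : Fin n} (hp : p ∈ A) (hsp : s p ≠ p) :
    partialSym A s hs hA ≠ 1 := by
  intro h
  have := congrArg (fun f : Perm (Fin n) => f p) h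
  simp [partialSym_apply, hp] at this
  exact hsp this

/-! ### The forward direction: every branch-free local triple is a partial symmetry

A local triple `(a, b)` is BRANCH-FREE if no vertex is moved by all three of `a`, `b`, `ab` (equivalently all orbits of
`⟨a, b⟩` have size ≤ 2).  Then with `A := supp a`, `B := supp b` and the pairing `s p := b p` if `a p = p`, `:= a p` otherwise,
`s` is an involution, `A`, `B`, `A ∆ B` are `s`-stable unions of `μ₀`-, `μ₁`-, `μ₂`-edges on which `s` intertwines `μ₀`, `μ₁`,
`μ₂`, and `a = s|A`, `b = s|B` — exactly the hypotheses of `localTriple_of_partialSymmetry` (theorem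
`partialSymmetry_of_localTriple`).  Reading: the "active" edges (`μ₀`-edges inside `A`, `μ₁`-edges inside `B`, `μ₂`-edges inside
`A ∆ B`) give every vertex of `A ∪ B` exactly two active colours, i.e. a vertex-disjoint union `Z` of cycles of `Γ`, and `s` is a
fixed-point-free colour-preserving involutive automorphism of `Z`: a disjoint union of SYMMETRIC CYCLES and TWIN PAIRS
(EVIDENCE-g2 Lemma 2.2 / Cor. 2.3).  So the two theorems together are the kernel-checked classification of branch-free local
triples; only the graph-theoretic reading is left on paper. -/

/-- The pairing map of a pair of permutations: `b p` where `a` fixes `p`, `a p` elsewhere. -/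
def pairingFun (a b : Perm (Fin n)) (p : Fin n) : Fin n := if a p = p then b p else a p

theorem pairingFun_of_eq (a b : Perm (Fin n)) {p : Fin n} (h : a p = p) : pairingFun a b p = b p := if_pos h
theorem pairingFun_of_ne (a b : Perm (Fin n)) {p : Fin n} (h : a p ≠ p) : pairingFun a b p = a p := if_neg h

section forward

variable (μ₀ μ₁ μ₂ a b : Perm (Fin n))

theorem perm_sq_apply {c : Perm (Fin n)} (hc : c * c = 1) (p : Fin n) : c (c p) = p := by
  have := congrArg (fun f : Perm (Fin n) => f p) hc; simpa using this

theorem perm_comm_apply {c d : Perm (Fin n)} (hcd : c * d = d * c) (p : Fin n) : c (d p) = d (c p) := by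
  have := congrArg (fun f : Perm (Fin n) => f p) hcd; simpa using this

/-- On `supp a ∩ supp b` the two involutions of a branch-free pair agree. -/
theorem pairing_agree (ha : a * a = 1) (hnb : ∀ p, a p ≠ p → b p ≠ p → a (b p) = p)
    (p : Fin n) (hap : a p ≠ p) (hbp : b p ≠ p) : b p = a p := by
  have h := hnb p hap hbp
  have : a (a (b p)) = a p := by rw [h]
  rwa [perm_sq_apply ha] at this

theorem pairingFun_involutive (ha : a * a = 1) (hb : b * b = 1) (hab : a * b = b * a) :
    Function.Involutive (pairingFun a b) := by
  intro p
  by_cases hap : a p = p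
  · have hq : a (b p) = b p := by rw [perm_comm_apply hab, hap]
    rw [pairingFun_of_eq a b hap, pairingFun_of_eq a b hq, perm_sq_apply hb]
  · have hq : a (a p) ≠ a p := by rw [perm_sq_apply ha]; exact fun h => hap h.symm
    rw [pairingFun_of_ne a b hap, pairingFun_of_ne a b hq, perm_sq_apply ha]

/-- For `p ∈ supp b` the pairing is `b p` (in both cases of the definition). -/
theorem pairingFun_eq_b (ha : a * a = 1) (hnb : ∀ p, a p ≠ p → b p ≠ p → a (b p) = p)
    (p : Fin n) (hbp : b p ≠ p) : pairingFun a b p = b p := by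
  by_cases hap : a p = p
  · exact pairingFun_of_eq a b hap
  · rw [pairingFun_of_ne a b hap, pairing_agree a b ha hnb p hap hbp]

/-- For `p ∈ supp a` the pairing is `a p`. -/
theorem pairingFun_eq_a (p : Fin n) (hap : a p ≠ p) : pairingFun a b p = a p := pairingFun_of_ne a b hap

/-- **Every branch-free local triple is a partial symmetry** (forward direction of the classification). -/
theorem partialSymmetry_of_localTriple (ha : a * a = 1) (hb : b * b = 1) (hab : a * b = b * a)
    (h0 : a * μ₀ = μ₀ * a) (h1 : b * μ₁ = μ₁ * b) (h2 : a * b * μ₂ = μ₂ * (a * b))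
    (hnb : ∀ p, a p ≠ p → b p ≠ p → a (b p) = p) :
    let s : Fin n → Fin n := pairingFun a b
    let A : Finset (Fin n) := Finset.univ.filter (fun p => a p ≠ p)
    let B : Finset (Fin n) := Finset.univ.filter (fun p => b p ≠ p)
    (∀ p, s (s p) = p) ∧
    (∀ p, p ∈ A ↔ s p ∈ A) ∧ (∀ p, p ∈ B ↔ s p ∈ B) ∧
    (∀ p, p ∈ A ↔ μ₀ p ∈ A) ∧ (∀ p ∈ A, s (μ₀ p) = μ₀ (s p)) ∧
    (∀ p, p ∈ B ↔ μ₁ p ∈ B) ∧ (∀ p ∈ B, s (μ₁ p) = μ₁ (s p)) ∧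
    (∀ p, p ∈ symmDiff A B ↔ μ₂ p ∈ symmDiff A B) ∧ (∀ p ∈ symmDiff A B, s (μ₂ p) = μ₂ (s p)) ∧
    (∀ p, a p = if p ∈ A then s p else p) ∧ (∀ p, b p = if p ∈ B then s p else p) := by
  intro s A B
  have hs : ∀ p, s (s p) = p := pairingFun_involutive a b ha hb hab
  have memA : ∀ p, p ∈ A ↔ a p ≠ p := fun p => by simp [A]
  have memB : ∀ p, p ∈ B ↔ b p ≠ p := fun p => by simp [B]
  -- the pairing restricted to A is a, restricted to B is b
  have sA : ∀ p, a p ≠ p → s p = a p := fun p h => pairingFun_eq_a a b p h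
  have sB : ∀ p, b p ≠ p → s p = b p := fun p h => pairingFun_eq_b a b ha hnb p h
  -- A ∆ B = supp (ab), and s = ab there
  have memAB : ∀ p, p ∈ symmDiff A B ↔ a (b p) ≠ p := by
    intro p
    rw [Finset.mem_symmDiff, memA, memB]
    by_cases hap : a p = p <;> by_cases hbp : b p = p
    · simp [hap, hbp]
    · have : a (b p) = b p := by rw [perm_comm_apply hab, hap]
      simp [hap, hbp, this]
    · simp [hap, hbp]
    · have : a (b p) = p := hnb p hap hbp
      simp [hap, hbp, this]
  have sAB : ∀ p, p ∈ symmDiff A B → s p = a (b p) := by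
    intro p hp
    rw [Finset.mem_symmDiff, memA, memB] at hp
    rcases hp with ⟨hap, hbp⟩ | ⟨hbp, hap⟩
    · push Not at hbp; rw [sA p hap, hbp]
    · push Not at hap; rw [sB p hbp, perm_comm_apply hab, hap]
  refine ⟨hs, ?_, ?_, ?_, ?_, ?_, ?_, ?_, ?_, ?_, ?_⟩
  · -- A is s-stable
    intro p; rw [memA, memA]
    by_cases hap : a p = p
    · have hq : a (b p) = b p := by rw [perm_comm_apply hab, hap]
      rw [show s p = b p from pairingFun_of_eq a b hap]
      exact ⟨fun h => absurd hap h, fun h => absurd hq h⟩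
    · rw [sA p hap, perm_sq_apply ha]
      exact ⟨fun _ h => hap h.symm, fun _ => hap⟩
  · -- B is s-stable
    intro p; rw [memB, memB]
    by_cases hbp : b p = p
    · by_cases hap : a p = p
      · rw [show s p = b p from pairingFun_of_eq a b hap, hbp, hbp]
      · have hq : b (a p) = a p := by rw [← perm_comm_apply hab, hbp]
        rw [sA p hap]
        exact ⟨fun h => absurd hbp h, fun h => absurd hq h⟩
    · rw [sB p hbp, perm_sq_apply hb]
      exact ⟨fun _ h => hbp h.symm, fun _ => hbp⟩
  · -- A is a union of μ₀-edges
    intro p; rw [memA, memA, perm_comm_apply h0]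
    exact (μ₀.injective.ne_iff).symm
  · -- s intertwines μ₀ on A
    intro p hp
    rw [memA] at hp
    have hp' : a (μ₀ p) ≠ μ₀ p := by rw [perm_comm_apply h0]; exact μ₀.injective.ne_iff.2 hp
    rw [sA _ hp', sA _ hp, perm_comm_apply h0]
  · intro p; rw [memB, memB, perm_comm_apply h1]
    exact (μ₁.injective.ne_iff).symm
  · intro p hp
    rw [memB] at hp
    have hp' : b (μ₁ p) ≠ μ₁ p := by rw [perm_comm_apply h1]; exact μ₁.injective.ne_iff.2 hp
    rw [sB _ hp', sB _ hp, perm_comm_apply h1]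
  · -- A ∆ B is a union of μ₂-edges
    intro p; rw [memAB, memAB]
    have e : a (b (μ₂ p)) = μ₂ (a (b p)) := perm_comm_apply h2 p
    rw [e]
    exact (μ₂.injective.ne_iff).symm
  · intro p hp
    have hp2 : μ₂ p ∈ symmDiff A B := by
      rw [memAB] at hp ⊢
      have e : a (b (μ₂ p)) = μ₂ (a (b p)) := perm_comm_apply h2 p
      rw [e]; exact μ₂.injective.ne_iff.2 hp
    rw [sAB _ hp2, sAB _ hp]
    exact perm_comm_apply h2 p
  · intro p
    by_cases hap : a p = p
    · have : p ∉ A := by rw [memA]; exact fun h => h hap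
      simp [this, hap]
    · have : p ∈ A := (memA p).2 hap
      simp [this, sA p hap]
  · intro p
    by_cases hbp : b p = p
    · have : p ∉ B := by rw [memB]; exact fun h => h hbp
      simp [this, hbp]
    · have : p ∈ B := (memB p).2 hbp
      simp [this, sB p hbp]

end forward

/-! ### Paired fixed points (EVIDENCE-g2 §3.1–3.3)
Reflection words `μx v⁻¹ μy v`, half-turn words `u u` and digon words `μi μj` never have isolated fixed points: this is why a host
with fixity ≤ 1 on short words has no symmetric cycles / digons except through relators. -/

section pairedFixedPoints

variable (μx μy v u : Perm (Fin n))

/-- 3.1: fixed points of a reflection word come in `M_x`-edges. -/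
theorem reflectionWord_fix_pair (hx : μx * μx = 1) (hy : μy * μy = 1) (p : Fin n)
    (h : (μx * v⁻¹ * μy * v) p = p) : (μx * v⁻¹ * μy * v) (μx p) = μx p := by
  have hxx : ∀ q, μx (μx q) = q := fun q => by
    have := congrArg (fun f : Perm (Fin n) => f q) hx; simpa using this
  have hyy : ∀ q, μy (μy q) = q := fun q => by
    have := congrArg (fun f : Perm (Fin n) => f q) hy; simpa using this
  simp only [Perm.coe_mul, Function.comp_apply] at h ⊢
  -- from h: v⁻¹ (μy (v p)) = μx p
  have h1 : v⁻¹ (μy (v p)) = μx p := by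
    have := congrArg μx h; rwa [hxx] at this
  -- hence μy (v p) = v (μx p)
  have h2 : μy (v p) = v (μx p) := by
    have := congrArg v h1; simpa using this
  -- so μy (v (μx p)) = v p
  have h3 : μy (v (μx p)) = v p := by rw [← h2, hyy]
  rw [h3]; simp

/-- 3.2: fixed points of a square come in `u`-orbits. -/
theorem squareWord_fix_pair (p : Fin n) (h : (u * u) p = p) : (u * u) (u p) = u p := by
  simp only [Perm.coe_mul, Function.comp_apply] at h ⊢
  rw [h]

/-- 3.3: a digon `μx p = μy p` gives two fixed points `p`, `μx p` of `μx μy`. -/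
theorem digon_fix_pair (hx : μx * μx = 1) (hy : μy * μy = 1) (p : Fin n) (h : μx p = μy p) :
    (μx * μy) p = p ∧ (μx * μy) (μx p) = μx p := by
  have hxx : ∀ q, μx (μx q) = q := fun q => by
    have := congrArg (fun f : Perm (Fin n) => f q) hx; simpa using this
  have hyy : ∀ q, μy (μy q) = q := fun q => by
    have := congrArg (fun f : Perm (Fin n) => f q) hy; simpa using this
  simp only [Perm.coe_mul, Function.comp_apply]
  refine ⟨?_, ?_⟩
  · rw [← h, hxx]
  · rw [h, hyy, h]

end pairedFixedPoints

/-! ### Commuting local triples multiply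
If `(a₁, b₁)` and `(a₂, b₂)` satisfy the local-triple relations and all four involutions pairwise commute, then so does
`(a₁a₂, b₁b₂)` (possibly trivial).  Overlapping commuting gadgets produce the BRANCH-type local triples of support 12 seen in random
hosts (kit j014921): they are products, not new minimal configurations. -/

theorem localTriple_mul (μ₀ μ₁ μ₂ a₁ b₁ a₂ b₂ : Perm (Fin n))
    (ha₁ : a₁ * a₁ = 1) (hb₁ : b₁ * b₁ = 1) (ha₂ : a₂ * a₂ = 1) (hb₂ : b₂ * b₂ = 1)
    (c11 : a₁ * b₁ = b₁ * a₁) (c22 : a₂ * b₂ = b₂ * a₂) (c12 : a₁ * a₂ = a₂ * a₁) (d12 : b₁ * b₂ = b₂ * b₁)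
    (e12 : a₁ * b₂ = b₂ * a₁) (e21 : a₂ * b₁ = b₁ * a₂)
    (h01 : a₁ * μ₀ = μ₀ * a₁) (h02 : a₂ * μ₀ = μ₀ * a₂) (h11 : b₁ * μ₁ = μ₁ * b₁) (h12 : b₂ * μ₁ = μ₁ * b₂)
    (h21 : a₁ * b₁ * μ₂ = μ₂ * (a₁ * b₁)) (h22 : a₂ * b₂ * μ₂ = μ₂ * (a₂ * b₂)) :
    let a := a₁ * a₂
    let b := b₁ * b₂
    a * a = 1 ∧ b * b = 1 ∧ a * b = b * a ∧ a * μ₀ = μ₀ * a ∧ b * μ₁ = μ₁ * b ∧ a * b * μ₂ = μ₂ * (a * b) := by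
  intro a b
  refine ⟨?_, ?_, ?_, ?_, ?_, ?_⟩
  · -- (a₁a₂)² = a₁a₂a₁a₂ = a₁a₁a₂a₂ = 1
    calc a₁ * a₂ * (a₁ * a₂) = a₁ * (a₂ * a₁) * a₂ := by group
      _ = a₁ * (a₁ * a₂) * a₂ := by rw [c12]
      _ = (a₁ * a₁) * (a₂ * a₂) := by group
      _ = 1 := by rw [ha₁, ha₂, one_mul]
  · calc b₁ * b₂ * (b₁ * b₂) = b₁ * (b₂ * b₁) * b₂ := by group
      _ = b₁ * (b₁ * b₂) * b₂ := by rw [d12]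
      _ = (b₁ * b₁) * (b₂ * b₂) := by group
      _ = 1 := by rw [hb₁, hb₂, one_mul]
  · -- a₁a₂b₁b₂ = b₁b₂a₁a₂
    calc a₁ * a₂ * (b₁ * b₂) = a₁ * (a₂ * b₁) * b₂ := by group
      _ = a₁ * (b₁ * a₂) * b₂ := by rw [e21]
      _ = (a₁ * b₁) * (a₂ * b₂) := by group
      _ = (b₁ * a₁) * (b₂ * a₂) := by rw [c11, c22]
      _ = b₁ * (a₁ * b₂) * a₂ := by group
      _ = b₁ * (b₂ * a₁) * a₂ := by rw [e12]
      _ = b₁ * b₂ * (a₁ * a₂) := by group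
  · calc a₁ * a₂ * μ₀ = a₁ * (a₂ * μ₀) := by group
      _ = a₁ * (μ₀ * a₂) := by rw [h02]
      _ = (a₁ * μ₀) * a₂ := by group
      _ = (μ₀ * a₁) * a₂ := by rw [h01]
      _ = μ₀ * (a₁ * a₂) := by group
  · calc b₁ * b₂ * μ₁ = b₁ * (b₂ * μ₁) := by group
      _ = b₁ * (μ₁ * b₂) := by rw [h12]
      _ = (b₁ * μ₁) * b₂ := by group
      _ = (μ₁ * b₁) * b₂ := by rw [h11]
      _ = μ₁ * (b₁ * b₂) := by group
  · -- (a₁a₂)(b₁b₂) = (a₁b₁)(a₂b₂) and both factors commute with μ₂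
    have e : a₁ * a₂ * (b₁ * b₂) = (a₁ * b₁) * (a₂ * b₂) := by
      calc a₁ * a₂ * (b₁ * b₂) = a₁ * (a₂ * b₁) * b₂ := by group
        _ = a₁ * (b₁ * a₂) * b₂ := by rw [e21]
        _ = (a₁ * b₁) * (a₂ * b₂) := by group
    rw [e]
    calc a₁ * b₁ * (a₂ * b₂) * μ₂ = (a₁ * b₁) * (a₂ * b₂ * μ₂) := by group
      _ = (a₁ * b₁) * (μ₂ * (a₂ * b₂)) := by rw [h22]
      _ = (a₁ * b₁ * μ₂) * (a₂ * b₂) := by group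
      _ = (μ₂ * (a₁ * b₁)) * (a₂ * b₂) := by rw [h21]
      _ = μ₂ * (a₁ * b₁ * (a₂ * b₂)) := by group

/-! ### Sanity instance
On `Fin 4` with `μ₀ = (01)(23)`, `μ₁ = (12)(30)`: the alternating 4-cycle `M₀ ∪ M₁` with the reflection `s = (03)(12)` through the
midpoints of the two `M₁`-edges (`A = B = univ`, `a = b = s`, `ab = 1`). -/
example : let μ₀ : Perm (Fin 4) := swap 0 1 * swap 2 3
    let μ₁ : Perm (Fin 4) := swap 1 2 * swap 3 0
    let s : Perm (Fin 4) := swap 0 3 * swap 1 2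
    s * s = 1 ∧ s * μ₀ = μ₀ * s ∧ s * μ₁ = μ₁ * s := by decide

end Summit.MatrixMultiplication.MatrixMultiplication.Cruxes.HyperoctahedralSubsets.DrefuteG2
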